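import Summits.AtomisticToContinuum.FouriersLaw.Theorems.ParityLiouvilleSeedLiouvilleForHeatHarmonicWindowDefs
import Summits.AtomisticToContinuum.FouriersLaw.Theorems.ParityLiouvilleSeedLiouvilleForHeatHarmonicGaussIBP
import Summits.AtomisticToContinuum.FouriersLaw.Theorems.ParityLiouvilleSeedLiouvilleForHeatHarmonicCurrent
import Literature.MathematicalPhysics.KineticTheory.InfiniteChainGibbsStationarityPinned

/-!
# The radiating Gaussian state of the harmonic chain is time invariant

Helper file for the harmonic tightness witness of `ParityLiouvilleSeed.LiouvilleForHeat`
(`stmt-AtomisticToContinuum-13980`) / `ZeroCurrentRigidity` (`stmt-AtomisticToContinuum-12073`).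

**Theorem** (`isTimeInvariant_harmonicState`): for `ω₂ > 0` the radiating Gaussian state
`harmonicState ω₂` is time invariant for the harmonic pinned chain `pinnedChain ω₂ 0 0 γ` in the
generator sense `IsTimeInvariant` (`∫ 𝒜f dν = 0`, `𝒜f ∈ L¹(ν)` for every `f ∈ C₀¹`).

Proof. The harmonic flow lifts through the field map to the linear noise drift `B` of
`…HarmonicWindowDefs` (`noiseDrift`): `q̇ = p` by construction and `ṗ_x = F_x`
(`pdot_eq_force`). For `f = g ∘ box_R`, `𝒜f(Φζ) = Dg(box Φζ)[box(BΦ… )] = D(g ∘ M)(z)[D z]`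
with `z` the restriction of the noise to the window `{-L,…,L} × Fin 3`, `L = R + 4`, `M` the window
field map and `D` the window drift (`liouvilleZ_gaussField_eq`; everything is local). The law of the
window noise is the product Gaussian `⊗ N(0, v_a)`, and `D` is SKEW for `diag v`
(`noiseDrift_single_skew`), so `∫ D(g∘M)(z)[Dz] = 0` by the skew-drift lemma of
`…HarmonicGaussIBP`.
-/

noncomputable section

open MeasureTheory ProbabilityTheory Filter
open scoped NNReal ENNReal
open Literature.MathematicalPhysics.KineticTheory.HeatConduction

namespace Summit.AtomisticToContinuum.FouriersLaw.Theorems.ParityLiouvilleSeed.HarmonicWitness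

variable (ω₂ : ℝ)

/-! ### Locality of the field, the force and the drift -/

/-- `p_x(ζ)` reads the noise only on the sites `x-2, …, x+1`. [folklore] -/
theorem gaussFieldP_congr {ζ ζ' : Src} {x : ℤ}
    (h : ∀ k : Idx, x - 2 ≤ k.1 → k.1 ≤ x + 1 → ζ k = ζ' k) : gaussFieldP ζ x = gaussFieldP ζ' x := by
  simp only [gaussFieldP]
  rw [h (x + 1, 0) (by dsimp only; omega) (by dsimp only; omega),
    h (x - 1, 0) (by dsimp only; omega) (by dsimp only; omega),
    h (x, 1) (by dsimp only; omega) (by dsimp only; omega),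
    h (x, 2) (by dsimp only; omega) (by dsimp only; omega),
    h (x - 1, 2) (by dsimp only; omega) (by dsimp only; omega),
    h (x - 2, 2) (by dsimp only; omega) (by dsimp only; omega)]

/-- `(q_x, p_x)(ζ)` reads the noise only on the sites `x-2, …, x+1`. [folklore] -/
theorem gaussField_congr {ζ ζ' : Src} {x : ℤ}
    (h : ∀ k : Idx, x - 2 ≤ k.1 → k.1 ≤ x + 1 → ζ k = ζ' k) : gaussField ζ x = gaussField ζ' x :=
  Prod.ext (h (x, 0) (by dsimp only; omega) (by dsimp only; omega)) (gaussFieldP_congr h)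

/-- The force of any chain at `x` reads the configuration only on `x-1, x, x+1`. [folklore] -/
theorem force_congr (P : OscillatorChain) {σ σ' : ChainConfig} {x : ℤ} (hm : σ (x - 1) = σ' (x - 1))
    (h0 : σ x = σ' x) (hp : σ (x + 1) = σ' (x + 1)) : P.force σ x = P.force σ' x := by
  simp only [OscillatorChain.force_eq, hm, h0, hp]

/-- The drift at `k` reads the noise only on the sites `k.1 - 2, …, k.1 + 2`. [folklore] -/
theorem noiseDrift_congr {ζ ζ' : Src} {k : Idx}
    (h : ∀ k' : Idx, k.1 - 2 ≤ k'.1 → k'.1 ≤ k.1 + 2 → ζ k' = ζ' k') :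
    noiseDrift ω₂ ζ k = noiseDrift ω₂ ζ' k := by
  obtain ⟨x, s⟩ := k
  fin_cases s
  · simp only [Fin.zero_eta, Fin.isValue, noiseDrift_apply_zero]
    exact gaussFieldP_congr fun k' h1 h2 => h k' (by dsimp only at h1 ⊢; omega) (by dsimp only at h2 ⊢; omega)
  · simp only [Fin.mk_one, Fin.isValue, noiseDrift_apply_one]
    rw [h (x, 0) (by dsimp only; omega) (by dsimp only; omega),
      h (x + 1, 1) (by dsimp only; omega) (by dsimp only; omega),
      h (x - 1, 1) (by dsimp only; omega) (by dsimp only; omega)]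
  · simp only [Fin.reduceFinMk, Fin.isValue, noiseDrift_apply_two]
    rw [h (x, 0) (by dsimp only; omega) (by dsimp only; omega),
      h (x + 1, 0) (by dsimp only; omega) (by dsimp only; omega),
      h (x + 2, 0) (by dsimp only; omega) (by dsimp only; omega),
      h (x + 1, 2) (by dsimp only; omega) (by dsimp only; omega),
      h (x - 1, 2) (by dsimp only; omega) (by dsimp only; omega)]

/-! ### The lift identities: `q̇ = p`, `ṗ = F` -/

/-- The harmonic force in the noise coordinates: `F_x = -(ω₂ + 2) ξ_x + ξ_{x+1} + ξ_{x-1}`. [folklore] -/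
theorem force_harmonic_gaussField (γ : ℝ) (ζ : Src) (x : ℤ) :
    (pinnedChain ω₂ 0 0 γ).force (gaussField ζ) x = -(ω₂ + 2) * ζ (x, 0) + ζ (x + 1, 0) + ζ (x - 1, 0) := by
  rw [OscillatorChain.force_eq, pinnedChain_deriv_U_eq, pinnedChain_deriv_V_eq]
  simp only [gaussField_apply_fst, zero_mul, add_zero]
  ring

/-- **`ṗ = F` along the drift**: differentiating `p_x(ζ)` along `ζ̇ = Bζ` gives the harmonic force.
[folklore] -/
theorem pdot_eq_force (γ : ℝ) (ζ : Src) (x : ℤ) :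
    (noiseDrift ω₂ ζ (x + 1, 0) - noiseDrift ω₂ ζ (x - 1, 0)) / 2 + noiseDrift ω₂ ζ (x, 1) +
        (noiseDrift ω₂ ζ (x, 2) - 2 * noiseDrift ω₂ ζ (x - 1, 2) + noiseDrift ω₂ ζ (x - 2, 2)) / 2 =
      (pinnedChain ω₂ 0 0 γ).force (gaussField ζ) x := by
  rw [force_harmonic_gaussField]
  simp only [noiseDrift_apply_zero, noiseDrift_apply_one, noiseDrift_apply_two, gaussFieldP]
  have e1 : x + 1 + 1 = x + 2 := by ring
  have e2 : x + 1 - 1 = x := by ring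
  have e3 : x + 1 - 2 = x - 1 := by ring
  have e4 : x - 1 + 1 = x := by ring
  have e5 : x - 1 - 1 = x - 2 := by ring
  have e6 : x - 1 - 2 = x - 3 := by ring
  have e7 : x - 1 + 2 = x + 1 := by ring
  have e8 : x - 2 + 1 = x - 1 := by ring
  have e9 : x - 2 + 2 = x := by ring
  have e10 : x - 2 - 1 = x - 3 := by ring
  simp only [e1, e2, e3, e4, e5, e6, e7, e8, e9, e10]
  ring

/-! ### Skewness of the drift for the noise covariance -/

/-- **The noise drift is skew for the noise covariance**: with `B_{kl} = (B e_l)_k` and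
`v = (1, ω₂, 1)` by species, `v_l B_{kl} = -v_k B_{lk}` (`ω₂ ≥ 0`). [folklore] -/
theorem noiseDrift_single_skew (hω : 0 ≤ ω₂) (k l : Idx) :
    (noiseVar ω₂ l.2 : ℝ) * noiseDrift ω₂ (Pi.single l 1) k =
      -((noiseVar ω₂ k.2 : ℝ) * noiseDrift ω₂ (Pi.single k 1) l) := by
  obtain ⟨x, s⟩ := k
  obtain ⟨y, t⟩ := l
  fin_cases s <;> fin_cases t <;>
    simp [gaussFieldP, Pi.single_apply, max_eq_left hω] <;>
    split_ifs <;> first | (exfalso; omega) | ring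

/-- The window drift inherits the skewness. [folklore] -/
theorem winDriftLin_skew (hω : 0 ≤ ω₂) (L : ℕ) (a b : WIdx L) :
    (noiseVar ω₂ b.2 : ℝ) * winDriftLin ω₂ L (Pi.single b 1) a =
      -((noiseVar ω₂ a.2 : ℝ) * winDriftLin ω₂ L (Pi.single a 1) b) := by
  simp only [winDriftLin_apply, winExt_single]
  exact noiseDrift_single_skew ω₂ hω (winIdx L a) (winIdx L b)

/-! ### The window picture of `𝒜f ∘ gaussField` -/

/-- The window field map evaluated on the restricted noise is the box of the field (`L ≥ R + 2`).
[folklore] -/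
theorem winFieldLin_winRestrict (R L : ℕ) (hL : R + 2 ≤ L) (ζ : Src) :
    winFieldLin R L (winRestrict L ζ) = boxRestrict R (gaussField ζ) := by
  rw [winFieldLin_apply]
  funext i
  simp only [boxRestrict_apply]
  have hi := i.2
  exact gaussField_congr fun k h1 h2 => winExt_winRestrict_of_mem L ζ k (by constructor <;> omega)

/-- Inside the window, the extension of the window drift is the drift of the extension. [folklore] -/
theorem winExt_winDriftLin (L : ℕ) (z : WIdx L → ℝ) (k : Idx) (hk : -(L : ℤ) ≤ k.1 ∧ k.1 ≤ L) :
    winExt L (winDriftLin ω₂ L z) k = noiseDrift ω₂ (winExt L z) k := by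
  rw [winExt_apply_of_mem L _ k hk, winDriftLin_apply]
  congr 1
  refine Prod.ext ?_ rfl
  simp only [winIdx_fst]
  omega

/-- A continuous linear functional on box vectors expanded along positions and momenta:
`T Y = ∑ᵢ ((Y i).1 T(e_i^q) + (Y i).2 T(e_i^p))`. [folklore] -/
theorem clm_box_apply_eq_sum {n : ℕ} (T : (Fin n → ℝ × ℝ) →L[ℝ] ℝ) (Y : Fin n → ℝ × ℝ) :
    T Y = ∑ i, ((Y i).1 * T (Pi.single i (1, 0)) + (Y i).2 * T (Pi.single i (0, 1))) := by
  conv_lhs => rw [← Finset.univ_sum_single Y, map_sum]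
  refine Finset.sum_congr rfl fun i _ => ?_
  have h : Pi.single (M := fun _ : Fin n => ℝ × ℝ) i (Y i) =
      (Y i).1 • Pi.single (M := fun _ : Fin n => ℝ × ℝ) i ((1 : ℝ), (0 : ℝ)) +
        (Y i).2 • Pi.single (M := fun _ : Fin n => ℝ × ℝ) i ((0 : ℝ), (1 : ℝ)) := by
    rw [← Pi.single_smul', ← Pi.single_smul', ← Pi.single_add]
    congr 1
    ext <;> simp
  rw [h, map_add, map_smul, map_smul, smul_eq_mul, smul_eq_mul]

/-- **The generator in the window picture.** For `f = g ∘ box_R` with `g` differentiable and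
`L ≥ R + 4`, `𝒜f(Φ ζ) = D(g ∘ M)(z)[D z]` where `z` is the window noise, `M` the window field
map and `D` the window drift. [folklore] -/
theorem liouvilleZ_gaussField_eq (γ : ℝ) (R L : ℕ) (hL : R + 4 ≤ L)
    {g : (Fin (2 * R + 1) → ℝ × ℝ) → ℝ} (hg : Differentiable ℝ g) (ζ : Src) :
    liouvilleZ (pinnedChain ω₂ 0 0 γ) (g ∘ boxRestrict R) (gaussField ζ) =
      fderiv ℝ (g ∘ ⇑(winFieldLin R L).toContinuousLinearMap) (winRestrict L ζ)
        (winDriftLin ω₂ L (winRestrict L ζ)) := by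
  set P := pinnedChain ω₂ 0 0 γ with hP
  set z := winRestrict L ζ with hz
  set M := (winFieldLin R L).toContinuousLinearMap with hM
  have hMz : M z = boxRestrict R (gaussField ζ) := by
    rw [hM, LinearMap.coe_toContinuousLinearMap', hz, winFieldLin_winRestrict R L (by omega) ζ]
  -- chain rule on the right
  rw [fderiv_comp _ (by rw [hMz]; exact hg _) M.differentiableAt, ContinuousLinearMap.fderiv,
    ContinuousLinearMap.comp_apply, hMz]
  -- the left-hand side as a box sum
  rw [liouvilleZ_comp_boxRestrict P R _ (hg _), clm_box_apply_eq_sum]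
  refine Finset.sum_congr rfl fun i _ => ?_
  have hi := i.2
  -- the vector `M (D z)` at box index `i`: `(p_{x_i}, F_{x_i})`
  have hwin : ∀ k : Idx, (i : ℤ) - R - 3 ≤ k.1 → k.1 ≤ (i : ℤ) - R + 2 →
      winExt L z k = ζ k := fun k h1 h2 =>
    winExt_winRestrict_of_mem L ζ k (by constructor <;> omega)
  have hcomp : M (winDriftLin ω₂ L z) i =
      ((gaussField ζ ((i : ℤ) - R)).2, P.force (gaussField ζ) ((i : ℤ) - R)) := by
    rw [hM, LinearMap.coe_toContinuousLinearMap', winFieldLin_apply, boxRestrict_apply]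
    refine Prod.ext ?_ ?_
    · rw [gaussField_apply_fst, winExt_winDriftLin ω₂ L z _ (by dsimp only; constructor <;> omega),
        noiseDrift_apply_zero, gaussField_apply_snd]
      exact gaussFieldP_congr fun k h1 h2 => hwin k (by omega) (by omega)
    · rw [gaussField_apply_snd, gaussFieldP]
      rw [winExt_winDriftLin ω₂ L z _ (by dsimp only; constructor <;> omega),
        winExt_winDriftLin ω₂ L z _ (by dsimp only; constructor <;> omega),
        winExt_winDriftLin ω₂ L z _ (by dsimp only; constructor <;> omega),
        winExt_winDriftLin ω₂ L z _ (by dsimp only; constructor <;> omega),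
        winExt_winDriftLin ω₂ L z _ (by dsimp only; constructor <;> omega),
        winExt_winDriftLin ω₂ L z _ (by dsimp only; constructor <;> omega),
        pdot_eq_force ω₂ γ, hP]
      refine force_congr _ ?_ ?_ ?_
      · exact gaussField_congr fun k h1 h2 => hwin k (by omega) (by omega)
      · exact gaussField_congr fun k h1 h2 => hwin k (by omega) (by omega)
      · exact gaussField_congr fun k h1 h2 => hwin k (by omega) (by omega)
  rw [hcomp]

/-! ### The window law and the conclusion -/

/-- **The law of the window noise** is the product Gaussian `⊗_a N(0, v_{a.2})`. [folklore] -/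
theorem noiseMeasure_map_winRestrict (L : ℕ) :
    (noiseMeasure ω₂).map (winRestrict L) = Measure.pi fun a : WIdx L => gaussianReal 0 (noiseVar ω₂ a.2) := by
  unfold noiseMeasure
  rw [show winRestrict L = fun (ζ : Src) (b : WIdx L) => ζ (winIdx L b) from rfl,
    Measure.map_infinitePi_infinitePi_of_inj (winIdx_injective L), Measure.infinitePi_eq_pi]
  rfl

/-- The window restriction is measurable. [folklore] -/
@[fun_prop]
theorem measurable_winRestrict (L : ℕ) : Measurable (winRestrict L : Src → WIdx L → ℝ) :=
  measurable_pi_lambda _ fun _ => measurable_pi_apply _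

/-- **`∫ 𝒜f dν = 0`** for the radiating state of the harmonic chain and every local test function.
[folklore] -/
theorem integral_liouvilleZ_harmonicState (hω : 0 < ω₂) (γ : ℝ) {f : ChainConfig → ℝ}
    (hf : IsLocalTestFunction f) :
    ∫ σ, liouvilleZ (pinnedChain ω₂ 0 0 γ) f σ ∂harmonicState ω₂ = 0 := by
  obtain ⟨R, g, hg, ⟨Mg, hMg⟩, ⟨Mg', hMg'⟩, rfl⟩ := hf
  set L : ℕ := R + 4 with hLdef
  set M := (winFieldLin R L).toContinuousLinearMap with hM
  set D := winDriftLin ω₂ L with hD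
  set H : (WIdx L → ℝ) → ℝ := g ∘ ⇑M with hH
  set v : WIdx L → ℝ≥0 := fun a => noiseVar ω₂ a.2 with hv
  have hv0 : ∀ a, v a ≠ 0 := by
    intro a
    obtain ⟨j, s⟩ := a
    fin_cases s
    · simp [hv]
    · simp [hv, noiseVar, hω]
    · simp [hv]
  have hgd : Differentiable ℝ g := hg.differentiable one_ne_zero
  -- the integrand in the window picture
  have hΘ : ∀ ζ : Src, liouvilleZ (pinnedChain ω₂ 0 0 γ) (g ∘ boxRestrict R) (gaussField ζ) =
      fderiv ℝ H (winRestrict L ζ) (D (winRestrict L ζ)) := fun ζ =>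
    liouvilleZ_gaussField_eq ω₂ γ R L le_rfl hgd ζ
  have hHc1 : ContDiff ℝ 1 H := hg.comp M.contDiff
  have hΘc : Continuous fun w : WIdx L → ℝ => fderiv ℝ H w (D w) :=
    (hHc1.continuous_fderiv one_ne_zero).clm_apply D.continuous_of_finiteDimensional
  rw [integral_harmonicState ω₂
    (((IsLocalTestFunction.measurable_liouvilleZ ⟨R, g, hg, ⟨Mg, hMg⟩, ⟨Mg', hMg'⟩, rfl⟩ _)).aestronglyMeasurable)]
  simp_rw [hΘ]
  rw [← integral_map (measurable_winRestrict L).aemeasurable hΘc.aestronglyMeasurable,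
    noiseMeasure_map_winRestrict]
  refine integral_fderiv_apply_skewDrift_eq_zero v hv0 D (fun a b => winDriftLin_skew ω₂ hω.le L a b)
    hHc1 ⟨Mg, fun w => hMg _⟩ ⟨Mg' * ‖M‖, fun w => ?_⟩
  rw [hH, fderiv_comp _ (hgd _) M.differentiableAt, ContinuousLinearMap.fderiv]
  exact (ContinuousLinearMap.opNorm_comp_le _ _).trans (mul_le_mul_of_nonneg_right (hMg' _) (norm_nonneg _))

/-- **`𝒜f ∈ L¹`** for the radiating state and every local test function (momenta and the linear
forces have all moments). [folklore] -/
theorem integrable_liouvilleZ_harmonicState (γ : ℝ) {f : ChainConfig → ℝ} (hf : IsLocalTestFunction f) :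
    Integrable (liouvilleZ (pinnedChain ω₂ 0 0 γ) f) (harmonicState ω₂) := by
  have hmom : ∀ (m : ℕ) (x : ℤ), Integrable (fun σ : ChainConfig => |(σ x).1| ^ m) (harmonicState ω₂) ∧
      Integrable (fun σ : ChainConfig => |(σ x).2| ^ m) (harmonicState ω₂) := fun m x => by
    obtain ⟨C, hC⟩ := moments_harmonicState ω₂ m
    exact OscillatorChain.integrable_abs_pow_of_add (hC x).1
  have h1 : ∀ x : ℤ, Integrable (fun σ : ChainConfig => |(σ x).1|) (harmonicState ω₂) := fun x => by
    simpa using (hmom 1 x).1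
  have h3 : ∀ x : ℤ, Integrable (fun σ : ChainConfig => |(σ x).1| ^ 3) (harmonicState ω₂) := fun x => (hmom 3 x).1
  have hp : ∀ x : ℤ, Integrable (fun σ : ChainConfig => (σ x).2) (harmonicState ω₂) := fun x => by
    have h := (hmom 1 x).2
    refine h.mono' (measurable_pi_apply x).snd.aestronglyMeasurable (Eventually.of_forall fun σ => ?_)
    simp [Real.norm_eq_abs]
  have hF := OscillatorChain.integrable_force_pinnedChain ω₂ 0 0 γ h1 h3
  obtain ⟨R, C, -, hC⟩ := hf.exists_abs_liouvilleZ_le (pinnedChain ω₂ 0 0 γ)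
  have hdom : Integrable (fun σ : ChainConfig => C * ∑ i : Fin (2 * R + 1),
      (|(σ ((i : ℤ) - R)).2| + |(pinnedChain ω₂ 0 0 γ).force σ ((i : ℤ) - R)|)) (harmonicState ω₂) :=
    (integrable_finsetSum _ fun i _ => ((hp _).abs.add (hF _).abs)).const_mul C
  refine hdom.mono' (hf.measurable_liouvilleZ _).aestronglyMeasurable (Eventually.of_forall fun σ => ?_)
  rw [Real.norm_eq_abs]
  exact hC σ

/-- **The radiating Gaussian state of the harmonic chain is time invariant** (generator sense,
Bernardin's `C₀¹` test class), for every `ω₂ > 0` and every (inert) bath coupling `γ`. [folklore] -/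
theorem isTimeInvariant_harmonicState (hω : 0 < ω₂) (γ : ℝ) :
    IsTimeInvariant (pinnedChain ω₂ 0 0 γ) (harmonicState ω₂) := fun _ hf =>
  ⟨integrable_liouvilleZ_harmonicState ω₂ γ hf, integral_liouvilleZ_harmonicState ω₂ hω γ hf⟩

end Summit.AtomisticToContinuum.FouriersLaw.Theorems.ParityLiouvilleSeed.HarmonicWitness

end
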